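import Mathlib
import Summits.Ventures.HodgeRepro2.T5SubgroupDescent

/-!
# T5ChevalleyReduction — the Chevalley step of §F.2 reduced to its printed input
(Tier-5 §G/N4.2 support)

Kernel witness behind the sentence of route/T5-route-3.md §F.2 (l. 83, on the record):
«ker(ψ_T|_Γ) has finite index in Γ, so by Chevalley's theorem on units (every finite-index subgroup
of a finitely generated subgroup of E^× contains a congruence subgroup, the modulus being choosable
prime to any given finite set of places — standard) some 𝔪 prime to T gives Γ_𝔪 ⊂ ker ψ_T».

The PRINTED input (Chevalley's theorem on units; it stays prose) is taken in its n-th-power form: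
for every `n ≥ 1` there is an admissible modulus `𝔪` (prime to `T`) such that every unit `≡ 1 (mod 𝔪)`
is an `n`-th power of a unit.  Everything after it is elementary and is proved here in abstract form:
`Γ` a commutative group (the norm-one units `E¹ ∩ O_E^×`, finitely generated by this seat's
`T5NormOneUnitsFG`), `U : ι → Subgroup Γ` a family of subgroups (the congruence subgroups `Γ_𝔪`),
`P : ι → Prop` an admissibility predicate (`𝔪` prime to `T`):

* `le_of_forall_pow_mem` — a subgroup consisting of `n`-th powers, `[Γ : K] ∣ n`, lies in `K`
  (Lagrange, `Subgroup.pow_index_mem`);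
* `exists_le_of_finiteIndex` — under the `n`-th-power hypothesis, every finite-index `K ≤ Γ` contains
  an admissible `U i` (the sentence as printed, «every finite-index subgroup … contains a congruence
  subgroup»);
* `exists_le_ker_of_pow_eq_one` — for a character `ψ : Γ →* Fˣ` of exponent `n` (`F` a field), an
  admissible `U i` lies in `ker ψ` (the finite index of `ker ψ` is this seat's
  `T5SubgroupDescent.finiteIndex_ker_of_pow_eq_one`; the direct route `ψ (g ^ n) = 1` is
  `exists_le_ker_of_pow_eq_one'`) — exactly the descent criterion «trivial on `Γ_𝔪`» of
  `T5SubgroupDescent.exists_descend_iff`, which feeds `T5PontryaginStep`.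

What stays prose: Chevalley's theorem itself (the `n`-th-power statement with a modulus prime to a
given finite set of places), the adelic objects, and the identification `Γ_𝔪 = E¹ ∩ H_𝔪`.
-/

namespace Summit.Ventures.HodgeRepro2.T5ChevalleyReduction

open Summit.Ventures.HodgeRepro2

variable {Γ : Type*} [CommGroup Γ]

/-- **Lagrange on a finite-index subgroup.** If every element of `U` is an `n`-th power and
`[Γ : K] ∣ n`, then `U ≤ K` (since `g ^ [Γ : K] ∈ K` for every `g`, `Subgroup.pow_index_mem`). -/
theorem le_of_forall_pow_mem (K U : Subgroup Γ) [K.FiniteIndex] (n : ℕ) (hn : K.index ∣ n)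
    (hU : ∀ u ∈ U, ∃ g : Γ, g ^ n = u) : U ≤ K := by
  intro u hu
  obtain ⟨g, rfl⟩ := hU u hu
  obtain ⟨k, hk⟩ := hn
  rw [hk, pow_mul]
  exact Subgroup.pow_mem _ (Subgroup.pow_index_mem K g) k

/-- **Chevalley's theorem, from its `n`-th-power form to the finite-index form.** Given a family
`U i` of subgroups (the congruence subgroups) with admissibility `P i` (modulus prime to `T`) such
that for every `n ≥ 1` some admissible `U i` consists of `n`-th powers (the printed input), every
subgroup `K` of finite index contains an admissible `U i`. -/
theorem exists_le_of_finiteIndex {ι : Type*} (U : ι → Subgroup Γ) (P : ι → Prop)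
    (hChev : ∀ n : ℕ, 0 < n → ∃ i, P i ∧ ∀ u ∈ U i, ∃ g : Γ, g ^ n = u)
    (K : Subgroup Γ) [K.FiniteIndex] : ∃ i, P i ∧ U i ≤ K := by
  obtain ⟨i, hi, hU⟩ := hChev K.index (Nat.pos_of_ne_zero Subgroup.FiniteIndex.index_ne_zero)
  exact ⟨i, hi, le_of_forall_pow_mem K (U i) K.index dvd_rfl hU⟩

/-- **The descent criterion met**: for a character `ψ : Γ →* Fˣ` of exponent `n ≠ 0` (`F` a field),
some admissible congruence subgroup `U i` lies in `ker ψ` — through the finite index of `ker ψ`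
(`T5SubgroupDescent.finiteIndex_ker_of_pow_eq_one`) and the finite-index form above. -/
theorem exists_le_ker_of_pow_eq_one {ι : Type*} (U : ι → Subgroup Γ) (P : ι → Prop)
    (hChev : ∀ n : ℕ, 0 < n → ∃ i, P i ∧ ∀ u ∈ U i, ∃ g : Γ, g ^ n = u)
    {F : Type*} [Field F] (ψ : Γ →* Fˣ) {n : ℕ} (hn : n ≠ 0) (hψ : ∀ g, ψ g ^ n = 1) :
    ∃ i, P i ∧ U i ≤ ψ.ker := by
  haveI := T5SubgroupDescent.finiteIndex_ker_of_pow_eq_one ψ hn hψ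
  exact exists_le_of_finiteIndex U P hChev ψ.ker

/-- The direct route, for any target group `M`: a character of exponent `n` kills every `n`-th power,
so the admissible `U i` of `n`-th powers lies in `ker ψ` without passing through the index. -/
theorem exists_le_ker_of_pow_eq_one' {ι : Type*} (U : ι → Subgroup Γ) (P : ι → Prop)
    (hChev : ∀ n : ℕ, 0 < n → ∃ i, P i ∧ ∀ u ∈ U i, ∃ g : Γ, g ^ n = u)
    {M : Type*} [Group M] (ψ : Γ →* M) {n : ℕ} (hn : 0 < n) (hψ : ∀ g, ψ g ^ n = 1) :
    ∃ i, P i ∧ U i ≤ ψ.ker := by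
  obtain ⟨i, hi, hU⟩ := hChev n hn
  refine ⟨i, hi, fun u hu => ?_⟩
  obtain ⟨g, rfl⟩ := hU u hu
  rw [MonoidHom.mem_ker, map_pow]
  exact hψ g

/-- The criterion in the form consumed by `T5SubgroupDescent.exists_descend_iff` /
`T5PontryaginStep`: for `H` a subgroup (the open `H_𝔪`), the restriction of `ψ` to `H`
is trivial on `H ⊓ U i` once `U i ≤ ker ψ`. -/
theorem eq_one_of_mem_of_le_ker (H U : Subgroup Γ) {M : Type*} [Group M] (ψ : Γ →* M)
    (hU : U ≤ ψ.ker) (h : H) (hh : (h : Γ) ∈ U) : ψ.restrict H h = 1 := by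
  rw [MonoidHom.restrict_apply]
  exact (MonoidHom.mem_ker).mp (hU hh)

end Summit.Ventures.HodgeRepro2.T5ChevalleyReduction
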